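import Summits.QuantumFields.YangMills.Theorems.AllWindowsColdBoxBoxHighLineSchurBlocks

/-!
# The row of `hodgeQ` at a SKIN link is the pure plaquette sum `Σ_q λ_q(s)·λ_q(e)`

For a skin link `s` (no endpoint an interior site) every gauge mode `g_x`, `x` interior, vanishes at `s`, so the Hodge precision matrix
row reduces to the Maxwell part: `hodgeQ s e = Σ_{q ∈ hodgePlaqs} landauCoeff q s · landauCoeff q e` (`hodgeQ_skin_eq_sum_landauCoeff`;
planner ym-idea-2 g17's identity `hodgeQ_skin_rest_eq_sum_landauCoeff`, STUB-PLAN-U1 §7, used by the plaquette-source route to the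
inputs a₂/a₃ of U1b/U1c of ⟨stmt-QuantumFields-24336⟩).  Corollary: the coupling block `coupling H s r` in the same form.

Everything proved; standard axioms.  HONEST LABEL: bookkeeping; no stub, crux, rung or summit is proved; the Yang–Mills mass gap is NOT proved
by this file.
-/

set_option autoImplicit false

noncomputable section

namespace Summit.QuantumFields.YangMills.Theorems.AllWindowsColdBoxBoxHighLine

open Finset Matrix
open Literature.Probability.LatticeModels (Site)
open Literature.MathematicalPhysics.QuantumFieldTheory
open Literature.MathematicalPhysics.QuantumFieldTheory.LatticeMaxwell
open Summit.QuantumFields.YangMills.Theorems.WeakCouplingRates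

namespace RestBlock

variable {H : ℕ}

/-- A gauge mode of an interior site vanishes on a skin link. -/
theorem gradVec_skin_eq_zero (s : Skin H) {x : Site 4} (hx : x ∈ interiorSites H) : gradVec H x s.1 = 0 := by
  unfold gradVec
  have h1 : s.1.1.1.1 + Pi.single s.1.1.1.2 1 ≠ x := fun h => s.2 (Or.inr (h ▸ hx))
  have h2 : s.1.1.1.1 ≠ x := fun h => s.2 (Or.inl (h ▸ hx))
  rw [if_neg h1, if_neg h2, sub_zero]

/-- **The row of `hodgeQ` at a skin link is the pure plaquette sum** `Σ_q λ_q(s)·λ_q(e)`. -/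
theorem hodgeQ_skin_eq_sum_landauCoeff (s : Skin H) (e : LandauFree H) :
    hodgeQ H s.1 e = ∑ q ∈ hodgePlaqs H, landauCoeff H q s.1 * landauCoeff H q e := by
  have h1 : hodgeQ H s.1 e = Pi.single s.1 (1 : ℝ) ⬝ᵥ (hodgeQ H *ᵥ Pi.single e 1) := by
    rw [Matrix.mulVec_single_one, single_one_dotProduct]; rfl
  rw [h1, dotProduct_hodgeQ_mulVec]
  have h2 : ∑ x ∈ interiorSites H, (gradVec H x ⬝ᵥ Pi.single s.1 (1 : ℝ)) * (gradVec H x ⬝ᵥ Pi.single e 1) = 0 := by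
    refine Finset.sum_eq_zero fun x hx => ?_
    rw [dotProduct_single_one, gradVec_skin_eq_zero s hx, zero_mul]
  rw [h2, add_zero]
  refine Finset.sum_congr rfl fun q _ => ?_
  rw [dotProduct_single_one, dotProduct_single_one]

/-- The coupling block in plaquette form: `coupling H s r = Σ_q λ_q(s)·λ_q(r)`. -/
theorem coupling_eq_sum_landauCoeff (s : Skin H) (r : Rest H) :
    coupling H s r = ∑ q ∈ hodgePlaqs H, landauCoeff H q s.1 * landauCoeff H q r.1 := by
  rw [coupling, Matrix.of_apply]
  exact hodgeQ_skin_eq_sum_landauCoeff s r.1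

/-- The skin block in plaquette form: `skinBlock H s s' = Σ_q λ_q(s)·λ_q(s')`. -/
theorem skinBlock_eq_sum_landauCoeff (s s' : Skin H) :
    skinBlock H s s' = ∑ q ∈ hodgePlaqs H, landauCoeff H q s.1 * landauCoeff H q s'.1 := by
  rw [skinBlock, Matrix.of_apply]
  exact hodgeQ_skin_eq_sum_landauCoeff s s'.1

end RestBlock

end Summit.QuantumFields.YangMills.Theorems.AllWindowsColdBoxBoxHighLine

end
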